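import Mathlib
import HarnessLib

/-!
# Local shifts of the fibre line

(Line `janus-bands`, crux `ArrangementNormalForm`, stub `stub_separateTwo`, part `Shift`.)
The second family of reparametrisations fed into the fibre-mass comparison lemma
(`SepTwo.lmass_comp_le`, part `Comparison`): the LOCAL SHIFT `smap m ℓ ρ δ τ = τ + δ · φ(τ − m)`
with the plateau `φ = 1` on the core `|u| ≤ ℓ`, `φ = 0` off the window `|u| ≥ ρ`, linear on the
buffers. For `|δ| ≤ (ρ − ℓ)/2` it translates the core by `δ`, fixes the complement of the
window, is a bi-Lipschitz (constants `1/2`, `3/2`) strictly increasing surjection of `ℝ`,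
differentiable off `|τ − m| ∈ {ℓ, ρ}` with `1/2 ≤ smap' ≤ 3/2`, and satisfies the ratio condition
of the comparison lemma with constant `3` for EVERY letter (`separateTwo_shift`). Composing such
shifts (disjoint windows) moves the anchors of the atom clusters between two nearby base points;
together with the window contractions of part `Window` this realises all comparisons of the
`stub_separateTwo` roadmap with controlled constants.
-/

noncomputable section

open Set

namespace Summit.KontsevichZagierPeriods.ArrangementNormalForm.JanusBands

namespace SepTwo

/-- The plateau: `1` on `|u| ≤ ℓ`, `0` on `|u| ≥ ρ`, linear in between. -/
def plateau (ℓ ρ u : ℝ) : ℝ := max 0 (min 1 ((ρ - |u|) / (ρ - ℓ)))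

/-- The local shift centred at `m`. -/
def smap (m ℓ ρ δ τ : ℝ) : ℝ := τ + δ * plateau ℓ ρ (τ - m)

/-- Its derivative off the break points `|τ − m| ∈ {ℓ, ρ}`. -/
def smapD (m ℓ ρ δ τ : ℝ) : ℝ :=
  if |τ - m| < ℓ then 1 else if |τ - m| < ρ then
    (if m < τ then 1 - δ / (ρ - ℓ) else 1 + δ / (ρ - ℓ)) else 1

/-- The shift is continuous. -/
theorem continuous_smap {m ℓ ρ δ : ℝ} : Continuous (smap m ℓ ρ δ) := by
  unfold smap plateau
  fun_prop

section Facts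

variable {m ℓ ρ δ : ℝ} (h : 0 < ℓ ∧ ℓ < ρ ∧ |δ| ≤ (ρ - ℓ) / 2)
include h

/-- The plateau on the core. -/
theorem plateau_eq_one {u : ℝ} (hu : |u| ≤ ℓ) : plateau ℓ ρ u = 1 := by
  have ⟨hℓ, hρ, hδ⟩ := h
  have h1 : 1 ≤ (ρ - |u|) / (ρ - ℓ) := by rw [le_div_iff₀ (by linarith)]; linarith
  unfold plateau; rw [min_eq_left h1, max_eq_right zero_le_one]

/-- The plateau off the window. -/
theorem plateau_eq_zero {u : ℝ} (hu : ρ ≤ |u|) : plateau ℓ ρ u = 0 := by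
  have ⟨hℓ, hρ, hδ⟩ := h
  have h1 : (ρ - |u|) / (ρ - ℓ) ≤ 0 := div_nonpos_of_nonpos_of_nonneg (by linarith) (by linarith)
  unfold plateau; rw [min_eq_right (by linarith), max_eq_left h1]

/-- The plateau on the closed buffer. -/
theorem plateau_eq_mid {u : ℝ} (hu1 : ℓ ≤ |u|) (hu2 : |u| ≤ ρ) :
    plateau ℓ ρ u = (ρ - |u|) / (ρ - ℓ) := by
  have ⟨hℓ, hρ, hδ⟩ := h
  have h0 : 0 ≤ (ρ - |u|) / (ρ - ℓ) := div_nonneg (by linarith) (by linarith)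
  have h1 : (ρ - |u|) / (ρ - ℓ) ≤ 1 := by rw [div_le_one (by linarith)]; linarith
  unfold plateau; rw [min_eq_right h1, max_eq_right h0]

/-- The plateau is `1/(ρ−ℓ)`-Lipschitz. -/
theorem abs_plateau_sub_le (u v : ℝ) : |plateau ℓ ρ u - plateau ℓ ρ v| ≤ |u - v| / (ρ - ℓ) := by
  have ⟨hℓ, hρ, hδ⟩ := h
  have hd : 0 < ρ - ℓ := by linarith
  unfold plateau
  refine (abs_max_sub_max_le_max _ _ _ _).trans (max_le (by simp; positivity) ?_)
  refine (abs_min_sub_min_le_max _ _ _ _).trans (max_le (by simp; positivity) ?_)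
  rw [← sub_div, abs_div, abs_of_pos hd, show ρ - |u| - (ρ - |v|) = |v| - |u| by ring]
  exact div_le_div_of_nonneg_right ((abs_abs_sub_abs_le_abs_sub v u).trans (abs_sub_comm v u).le)
    hd.le

/-- The shift is a perturbation of the identity by at most half the distance. -/
theorem abs_smap_sub_sub_le (x y : ℝ) :
    |(smap m ℓ ρ δ x - smap m ℓ ρ δ y) - (x - y)| ≤ |x - y| / 2 := by
  have ⟨hℓ, hρ, hδ⟩ := h
  have hd : 0 < ρ - ℓ := by linarith
  have h1 := abs_plateau_sub_le h (x - m) (y - m)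
  rw [show x - m - (y - m) = x - y by ring] at h1
  unfold smap
  rw [show x + δ * plateau ℓ ρ (x - m) - (y + δ * plateau ℓ ρ (y - m)) - (x - y) =
    δ * (plateau ℓ ρ (x - m) - plateau ℓ ρ (y - m)) by ring, abs_mul]
  calc |δ| * |plateau ℓ ρ (x - m) - plateau ℓ ρ (y - m)| ≤ (ρ - ℓ) / 2 * (|x - y| / (ρ - ℓ)) :=
        mul_le_mul hδ h1 (abs_nonneg _) (by linarith)
    _ = |x - y| / 2 := by field_simp

/-- Lower bi-Lipschitz bound. -/
theorem le_abs_smap_sub (x y : ℝ) : |x - y| / 2 ≤ |smap m ℓ ρ δ x - smap m ℓ ρ δ y| := by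
  have h1 := abs_smap_sub_sub_le (m := m) h x y
  have h2 := abs_sub_abs_le_abs_sub (x - y) (smap m ℓ ρ δ x - smap m ℓ ρ δ y)
  rw [abs_sub_comm] at h1
  linarith

/-- The shift is strictly increasing. -/
theorem strictMono_smap : StrictMono (smap m ℓ ρ δ) := fun x y hxy => by
  have h1 := abs_smap_sub_sub_le (m := m) h y x
  have h2 : 0 < y - x := sub_pos.2 hxy
  rw [abs_of_pos h2] at h1
  have h3 := (abs_le.1 h1).1
  linarith

/-- The shift translates the core. -/
theorem smap_eq_core {τ : ℝ} (hτ : |τ - m| ≤ ℓ) : smap m ℓ ρ δ τ = τ + δ := by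
  unfold smap; rw [plateau_eq_one h hτ, mul_one]

/-- The shift fixes the complement of the window. -/
theorem smap_eq_self {τ : ℝ} (hτ : ρ ≤ |τ - m|) : smap m ℓ ρ δ τ = τ := by
  unfold smap; rw [plateau_eq_zero h hτ, mul_zero, add_zero]

/-- The shift is surjective. -/
theorem surjective_smap : Function.Surjective (smap m ℓ ρ δ) := by
  have ⟨hℓ, hρ, hδ⟩ := h
  refine (continuous_smap (m := m) (ℓ := ℓ) (ρ := ρ) (δ := δ)).surjective ?_ ?_
  · refine Filter.tendsto_atTop_atTop.2 fun b => ⟨max b (m + ρ), fun v hv => ?_⟩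
    have hvρ : ρ ≤ |v - m| := by
      rw [abs_of_nonneg (by linarith [le_max_right b (m + ρ)])]; linarith [le_max_right b (m + ρ)]
    rw [smap_eq_self h hvρ]; exact (le_max_left _ _).trans hv
  · refine Filter.tendsto_atBot_atBot.2 fun b => ⟨min b (m - ρ), fun v hv => ?_⟩
    have hvρ : ρ ≤ |v - m| := by
      rw [abs_of_nonpos (by linarith [min_le_right b (m - ρ)])]; linarith [min_le_right b (m - ρ)]
    rw [smap_eq_self h hvρ]; exact hv.trans (min_le_left _ _)

/-- Derivative of the shift off the break points. -/
theorem hasDerivAt_smap {τ : ℝ} (h1 : |τ - m| ≠ ℓ) (h2 : |τ - m| ≠ ρ) :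
    HasDerivAt (smap m ℓ ρ δ) (smapD m ℓ ρ δ τ) τ := by
  have ⟨hℓ, hρ, hδ⟩ := h
  unfold smapD
  by_cases hc : |τ - m| < ℓ
  · rw [if_pos hc]
    have heq : (fun w => w + δ) =ᶠ[nhds τ] smap m ℓ ρ δ := by
      filter_upwards [Ioo_mem_nhds (show m - ℓ < τ by linarith [(abs_lt.1 hc).1])
        (show τ < m + ℓ by linarith [(abs_lt.1 hc).2])] with w hw
      exact (smap_eq_core h (abs_le.2 ⟨by linarith [hw.1], by linarith [hw.2]⟩)).symm
    exact ((hasDerivAt_id τ).add_const δ).congr_of_eventuallyEq heq.symm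
  rw [if_neg hc]
  have hc' : ℓ < |τ - m| := lt_of_le_of_ne (not_lt.1 hc) (Ne.symm h1)
  by_cases hb : |τ - m| < ρ
  · rw [if_pos hb]
    by_cases hs : m < τ
    · have ha : |τ - m| = τ - m := abs_of_pos (sub_pos.2 hs)
      rw [if_pos hs]
      rw [ha] at hc' hb
      have heq : (fun w => w + δ * ((ρ - (w - m)) / (ρ - ℓ))) =ᶠ[nhds τ] smap m ℓ ρ δ := by
        filter_upwards [Ioo_mem_nhds (show m + ℓ < τ by linarith) (show τ < m + ρ by linarith)]
          with w hw
        have hw' : |w - m| = w - m := abs_of_pos (by linarith [hw.1])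
        show _ = smap m ℓ ρ δ w
        rw [smap, plateau_eq_mid h (by rw [hw']; linarith [hw.1]) (by rw [hw']; linarith [hw.2]), hw']
      have hd := ((hasDerivAt_id τ).add ((((hasDerivAt_id τ).sub_const m).const_sub ρ).div_const
        (ρ - ℓ) |>.const_mul δ)).congr_deriv (show _ = 1 - δ / (ρ - ℓ) by ring)
      exact hd.congr_of_eventuallyEq heq.symm
    · have hs' : τ - m < 0 := lt_of_le_of_ne (by linarith) fun h0 => by
        rw [h0, abs_zero] at hc'; linarith
      rw [if_neg hs]
      rw [abs_of_neg hs'] at hc' hb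
      have heq : (fun w => w + δ * ((ρ + (w - m)) / (ρ - ℓ))) =ᶠ[nhds τ] smap m ℓ ρ δ := by
        filter_upwards [Ioo_mem_nhds (show m - ρ < τ by linarith) (show τ < m - ℓ by linarith)]
          with w hw
        have hw' : |w - m| = -(w - m) := abs_of_neg (by linarith [hw.2])
        show _ = smap m ℓ ρ δ w
        rw [smap, plateau_eq_mid h (by rw [hw']; linarith [hw.2]) (by rw [hw']; linarith [hw.1]), hw']
        ring
      have hd := ((hasDerivAt_id τ).add ((((hasDerivAt_id τ).sub_const m).const_add ρ).div_const
        (ρ - ℓ) |>.const_mul δ)).congr_deriv (show _ = 1 + δ / (ρ - ℓ) by ring)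
      exact hd.congr_of_eventuallyEq heq.symm
  · rw [if_neg hb]
    have hb' : ρ < |τ - m| := lt_of_le_of_ne (not_lt.1 hb) (Ne.symm h2)
    have heq : (fun w => w) =ᶠ[nhds τ] smap m ℓ ρ δ := by
      rcases le_or_gt 0 (τ - m) with h0 | h0
      · rw [abs_of_nonneg h0] at hb'
        filter_upwards [Ioi_mem_nhds (show m + ρ < τ by linarith)] with w (hw : m + ρ < w)
        exact (smap_eq_self h (by rw [abs_of_nonneg (by linarith)]; linarith)).symm
      · rw [abs_of_neg h0] at hb'
        filter_upwards [Iio_mem_nhds (show τ < m - ρ by linarith)] with w (hw : w < m - ρ)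
        exact (smap_eq_self h (by rw [abs_of_neg (by linarith)]; linarith)).symm
    exact (hasDerivAt_id τ).congr_of_eventuallyEq heq.symm

/-- `1/2 ≤ smap' ≤ 3/2`. -/
theorem smapD_bounds (τ : ℝ) : 1 / 2 ≤ smapD m ℓ ρ δ τ ∧ smapD m ℓ ρ δ τ ≤ 3 / 2 := by
  have ⟨hℓ, hρ, hδ⟩ := h
  have hq : |δ / (ρ - ℓ)| ≤ 1 / 2 := by
    rw [abs_div, abs_of_pos (by linarith : 0 < ρ - ℓ), div_le_iff₀ (by linarith)]; linarith
  obtain ⟨hq1, hq2⟩ := abs_le.1 hq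
  unfold smapD
  split_ifs <;> constructor <;> linarith

/-- **Ratio condition** for every letter. -/
theorem smap_ratio (τ γ : ℝ) :
    smapD m ℓ ρ δ τ * |τ - γ| ≤ 3 * |smap m ℓ ρ δ τ - smap m ℓ ρ δ γ| := by
  have h1 := (smapD_bounds (m := m) h τ).2
  have h2 := le_abs_smap_sub (m := m) h τ γ
  nlinarith [abs_nonneg (τ - γ)]

end Facts

end SepTwo

/-- **Local shift of the fibre line** (registered sub-goal of `stub_separateTwo`): for
`0 < ℓ < ρ` and `|δ| ≤ (ρ − ℓ)/2`, `SepTwo.smap m ℓ ρ δ` translates the core `|τ − m| ≤ ℓ` by `δ`,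
fixes `|τ − m| ≥ ρ`, is a strictly increasing surjection of `ℝ`, differentiable off
`|τ − m| ∈ {ℓ, ρ}` with derivative `SepTwo.smapD m ℓ ρ δ ∈ [1/2, 3/2]`, and satisfies the ratio
condition of the comparison lemma with constant `3` for every letter. -/
theorem separateTwo_shift (m ℓ ρ δ : ℝ) (hℓ : 0 < ℓ) (hρ : ℓ < ρ) (hδ : |δ| ≤ (ρ - ℓ) / 2) : StrictMono (SepTwo.smap m ℓ ρ δ) ∧ Function.Surjective (SepTwo.smap m ℓ ρ δ) ∧ (∀ τ, |τ - m| ≠ ℓ → |τ - m| ≠ ρ → HasDerivAt (SepTwo.smap m ℓ ρ δ) (SepTwo.smapD m ℓ ρ δ τ) τ) ∧ (∀ τ, 1 / 2 ≤ SepTwo.smapD m ℓ ρ δ τ ∧ SepTwo.smapD m ℓ ρ δ τ ≤ 3 / 2) ∧ (∀ τ γ, SepTwo.smapD m ℓ ρ δ τ * |τ - γ| ≤ 3 * |SepTwo.smap m ℓ ρ δ τ - SepTwo.smap m ℓ ρ δ γ|) ∧ (∀ τ, |τ - m| ≤ ℓ → SepTwo.smap m ℓ ρ δ τ = τ + δ)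 ∧ (∀ τ, ρ ≤ |τ - m| → SepTwo.smap m ℓ ρ δ τ = τ) := by
  have h : 0 < ℓ ∧ ℓ < ρ ∧ |δ| ≤ (ρ - ℓ) / 2 := ⟨hℓ, hρ, hδ⟩
  exact ⟨SepTwo.strictMono_smap h, SepTwo.surjective_smap h,
    fun τ h1 h2 => SepTwo.hasDerivAt_smap h h1 h2,
    SepTwo.smapD_bounds h, SepTwo.smap_ratio h, fun τ hτ => SepTwo.smap_eq_core h hτ,
    fun τ hτ => SepTwo.smap_eq_self h hτ⟩

end Summit.KontsevichZagierPeriods.ArrangementNormalForm.JanusBands
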